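import Literature.NumberTheory.ComplexMultiplication.CMTypeDictionaryGroupLevel
import Literature.NumberTheory.ComplexMultiplication.EmbeddingAction
import Literature.NumberTheory.ComplexMultiplication.InducedCMType
import HarnessLib

/-!
# A non-primitive CM type is induced from a proper subfield (Shimura 1998 §8.2, Prop. 26; Streng 2010 Ch. I (3.6))

Layer `Literature/NumberTheory/ComplexMultiplication`; KERNEL ONLY (theorems; no definition, no named fact;
D-0026).

THE PRINT.  Shimura, *Abelian Varieties with Complex Multiplication and Modular Functions* (1998) §8.2 (held text
`book:shimura1998-abelian-varieties-with-complex-multiplication-modular-functions`, chunk p0081 L1–L11): a CM type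
`(F; {φᵢ})` and «`H₁` the subgroup of `G` corresponding to `F`.  Put `H' = {γ ∈ G | γS = S}`»; the proof of
PROPOSITION 26 reads the type `S = ⋃ᵢ φᵢ H₁` on the subfield `K'` of `F` corresponding to `H'`: «`F` contains the
field `K'` corresponding to `H'` … the `φᵢ` induce a CM-type of `K'`» and «`(F; {φᵢ})` is primitive if and only if
`H₁ = H'`».  Streng, *Complex multiplication of abelian surfaces* (2010) Ch. I, Def. 3.2 («The CM-type of `K₂`
induced by `Φ` is `Φ_{K₂} = {φ ∈ Hom(K₂, L′) : φ|_{K₁} ∈ Φ}`»), (3.6) and Lemma 3.5 (`Gal(L/K₁) = {σ | Φ_L σ = Φ_L}`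
for the smallest field `K₁` from which `Φ` is induced).

WHAT IS PROVED, for a number field `M` and a CM type `Φ ⊆ Hom(M, ℂ)` (the tree's `Motives.CMType M`), in the
`Aut(ℂ)`-language of the tree's primitivity criterion (`ComplexMultiplication.isPrimitive_ringEquiv_complex_iff`:
`Φ` is primitive iff embeddings `s, t : M → ℂ` with `τ ∘ s ∈ Φ ⟺ τ ∘ t ∈ Φ` for all `τ ∈ Aut(ℂ)` coincide):

* `exists_inducedCMType_of_not_primitive` — if two DISTINCT embeddings `s ≠ t` have the same pattern
  `τ ↦ [τ ∘ s ∈ Φ]`, then there are a PROPER subfield `K ⊊ M` (an `IntermediateField ℚ M`, `K ≠ ⊤`) and a CM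
  type `Φ₀` of `K` with `Φ = Φ₀^M` (`inducedCMType (algebraMap K M) Φ₀ = Φ`).  `K` is Shimura's `K'`: the
  fixed field of `H'` in a Galois closure `L ⊇ M` (computed with the tree's `reflexLift` / `typeLift`,
  `MulAction.stabilizer _ (reflexLift _ _)` = `H'` by `mem_stabilizer_reflexLift_iff`), pulled back to `M`.

* conversely `exists_ne_of_inducedCMType` (§4) — a type induced from a proper subfield (`[K:ℚ] < [M:ℚ]`, or `k`
  not surjective) has two distinct embeddings with the same pattern (two of the `[M:K] ≥ 2` extensions of one
  embedding of `K`, Mathlib's `AlgHom.card`); together `primitive_iff_not_exists_inducedCMType`: **the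
  `Aut(ℂ)`-primitivity of the tree is Streng's «not induced from a CM type of a strict subfield» (Def. 3.2)**,
  Shimura's «`H₁ = H'`» read on CM types.

The Galois-theoretic core is stated for any Galois number field `L` receiving `M` (`j : M →ₐ[ℚ] L`) with a
complex embedding `ι : L → ℂ`:
* `mem_iff_mem_of_forall_mem_fixedField` — two complex embeddings of `M` that agree on (the pull-back of)
  `L^{H'}` lie in `Φ` together (the Galois correspondence `Gal(L/L^{H'}) = H'`, Mathlib's
  `IntermediateField.fixingSubgroup_fixedField`, and the defining property of `H'`);
* `exists_not_mem_fixedField_of_ne` — if `s ≠ t` have the same `Aut(ℂ)`-pattern then `L^{H'} ⊉ j(M)`, i.e.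
  `H' ≠ H₁` (the patterns are transported from `Aut(ℂ)` to `Gal(L/ℚ)` by the tree's dictionary
  `exists_ringEquiv_forall_algHomEquivRingHomOfNormal_smul`).

The instantiation takes `L = M^c ⊂ ℂ` (`GaoUllmo2025.galoisClosure`, Galois over `ℚ`:
`isGalois_galoisClosure`).  Consumer: `AlgebraicGeometry/ComplexMultiplication/SimpleIffPrimitiveCMType` — with
Shimura §6.2 Thm. 3 (last clause; tree theorem `not_isSimple_of_isCMTypeRealisation_inducedCMType`) this is the
half «not primitive ⟹ not simple» of Prop. 26.

## References
* [Shimura1998] G. Shimura, *Abelian Varieties with Complex Multiplication and Modular Functions* (Princeton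
  1998), §8.2 Prop. 26 and its proof (printed pp. 61–63; held chunk p0081 L1–L11), §8.1 Prop. 25.
* [Streng2010] M. Streng, *Complex multiplication of abelian surfaces*, PhD thesis, Leiden (2010), Ch. I Def. 3.2,
  Lemma 3.5, (3.6).
-/

noncomputable section

open scoped Pointwise

namespace Literature.NumberTheory.ComplexMultiplication

open Literature.AlgebraicGeometry.Motives (CMType)
open NumberField

/-! ## §1 The Galois-theoretic core over a Galois number field `L ⊇ M` -/

section Galois

variable {L : Type} [Field L] [NumberField L] [IsGalois ℚ L] {M : Type} [Field M] [Algebra ℚ M]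
  (j : M →ₐ[ℚ] L) (ι : L →+* ℂ) (Ψ : Set (M →+* ℂ))

/-- `g • j ∈ Ψ_L ↔ ι ∘ (g • j) ∈ Ψ`, with `ι ∘ (g • j)` the image of `g • j` under the bijection
`Hom_ℚ(M, L) ≃ Hom(M, ℂ)` (private helper). [folklore] -/
private theorem smul_mem_algValuedIn_iff (g : L ≃ₐ[ℚ] L) :
    g • j ∈ algValuedIn ι Ψ ↔ algHomEquivRingHomOfNormal j ι (g • j) ∈ Ψ := by
  rw [mem_algValuedIn_iff, algHomEquivRingHomOfNormal_apply]

/-- **Embeddings agreeing on `K' = L^{H'}` lie in `Φ` together.**  Let `Ψ ⊆ Hom(M, ℂ)`, read in `Hom_ℚ(M, L)`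
through `ι` (`Ψ_L = algValuedIn ι Ψ`), and let `H' = {u ∈ Gal(L/ℚ) | S u = S}` be the right stabiliser of
`S = {g | g ∘ j ∈ Ψ_L}` (`MulAction.stabilizer _ (reflexLift Ψ_L j)`, `mem_stabilizer_reflexLift_iff`).  If
`σ, σ' : M → ℂ` agree at every `x ∈ M` with `j x ∈ L^{H'}`, then `σ ∈ Ψ ↔ σ' ∈ Ψ`: writing `σ = ι ∘ a ∘ j`,
`σ' = ι ∘ b ∘ j` (`L/ℚ` normal), `a⁻¹ b` fixes `L^{H'}` (which lies in `j(M)`, Streng Lemma 7.2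
`fixedField_stabilizer_reflexLift_le_fieldRange`), so `a⁻¹ b ∈ Gal(L/L^{H'}) = H'` (Galois correspondence) and
`b = a (a⁻¹ b) ∈ S ↔ a ∈ S`. [cite: Shimura1998, §8.2 proof of Prop. 26] [cite: Streng2010, Ch. I Lemma 3.5 and (3.6)] -/
theorem mem_iff_mem_of_forall_mem_fixedField (σ σ' : M →+* ℂ)
    (h : ∀ x : M, j x ∈ IntermediateField.fixedField
        (MulAction.stabilizer (L ≃ₐ[ℚ] L) (reflexLift (algValuedIn ι Ψ) j : Set (L ≃ₐ[ℚ] L))) →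
      σ x = σ' x) :
    σ ∈ Ψ ↔ σ' ∈ Ψ := by
  set H' := MulAction.stabilizer (L ≃ₐ[ℚ] L) (reflexLift (algValuedIn ι Ψ) j : Set (L ≃ₐ[ℚ] L)) with hH'
  let e := algHomEquivRingHomOfNormal j ι
  -- `σ = ι ∘ (a • j)`, `σ' = ι ∘ (b • j)`
  obtain ⟨a, ha⟩ := exists_algEquiv_smul_eq j (e.symm σ)
  obtain ⟨b, hb⟩ := exists_algEquiv_smul_eq j (e.symm σ')
  have hσ : e (a • j) = σ := by rw [ha, Equiv.apply_symm_apply]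
  have hσ' : e (b • j) = σ' := by rw [hb, Equiv.apply_symm_apply]
  -- `a⁻¹ b` fixes `L^{H'} ⊆ j(M)` pointwise
  have hle : IntermediateField.fixedField H' ≤ j.fieldRange :=
    fixedField_stabilizer_reflexLift_le_fieldRange (algValuedIn ι Ψ) j
  have hfix : a⁻¹ * b ∈ (IntermediateField.fixedField H').fixingSubgroup := by
    rw [IntermediateField.mem_fixingSubgroup_iff]
    intro y hy
    obtain ⟨x, rfl⟩ : ∃ x, j x = y := by
      have := hle hy
      rwa [AlgHom.mem_fieldRange] at this
    have hx : σ x = σ' x := h x hy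
    rw [← hσ, ← hσ', algHomEquivRingHomOfNormal_apply, algHomEquivRingHomOfNormal_apply, RingHom.comp_apply,
      RingHom.comp_apply] at hx
    have hx' : (a • j) x = (b • j) x := ι.injective hx
    rw [algEquiv_smul_apply, algEquiv_smul_apply] at hx'
    rw [AlgEquiv.mul_apply, ← hx', ← AlgEquiv.mul_apply, inv_mul_cancel, AlgEquiv.one_apply]
  -- Galois correspondence: `Gal(L/L^{H'}) = H'`
  have hu : a⁻¹ * b ∈ H' := by
    rwa [IntermediateField.fixingSubgroup_fixedField] at hfix
  -- the defining property of `H'`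
  have key := (mem_stabilizer_reflexLift_iff (algValuedIn ι Ψ) j (a⁻¹ * b)).1 hu a
  rw [mul_inv_cancel_left, mem_typeLift, mem_typeLift, smul_mem_algValuedIn_iff, smul_mem_algValuedIn_iff,
    hσ, hσ'] at key
  exact key.symm

/-- **Two distinct embeddings with the same `Aut(ℂ)`-pattern force `L^{H'} ⊉ j(M)`** (`H' ≠ H₁`, the failure of
primitivity in Shimura's form): if `s ≠ t : M → ℂ` satisfy `τ ∘ s ∈ Ψ ⟺ τ ∘ t ∈ Ψ` for every `τ ∈ Aut(ℂ)`, then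
some `x ∈ M` has `j x ∉ L^{H'}`.  Indeed `s = ι ∘ (a • j)`, `t = ι ∘ (c • j)` and `a⁻¹ c ∈ H'` (every element
of `Gal(L/ℚ)` acts on `Hom(M, ℂ)` through some `τ ∈ Aut(ℂ)`, the tree's
`exists_ringEquiv_forall_algHomEquivRingHomOfNormal_smul`), while `a⁻¹ c` moves `j` because `s ≠ t`.
[cite: Shimura1998, §8.2 Prop. 26] [cite: Streng2010, Ch. I Def. 3.2 and (3.6)] -/
theorem exists_not_mem_fixedField_of_ne {s t : M →+* ℂ} (hst : s ≠ t)
    (hpat : ∀ τ : ℂ ≃+* ℂ, (τ : ℂ →+* ℂ).comp s ∈ Ψ ↔ (τ : ℂ →+* ℂ).comp t ∈ Ψ) :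
    ∃ x : M, j x ∉ IntermediateField.fixedField
      (MulAction.stabilizer (L ≃ₐ[ℚ] L) (reflexLift (algValuedIn ι Ψ) j : Set (L ≃ₐ[ℚ] L))) := by
  set H' := MulAction.stabilizer (L ≃ₐ[ℚ] L) (reflexLift (algValuedIn ι Ψ) j : Set (L ≃ₐ[ℚ] L)) with hH'
  let e := algHomEquivRingHomOfNormal j ι
  obtain ⟨a, ha⟩ := exists_algEquiv_smul_eq j (e.symm s)
  obtain ⟨c, hc⟩ := exists_algEquiv_smul_eq j (e.symm t)
  have hs : e (a • j) = s := by rw [ha, Equiv.apply_symm_apply]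
  have ht : e (c • j) = t := by rw [hc, Equiv.apply_symm_apply]
  have hsm : ∀ (τ : ℂ ≃+* ℂ) (σ : M →+* ℂ), τ • σ = (τ : ℂ →+* ℂ).comp σ := fun τ σ ↦ by
    rw [ringEquiv_smul_def, RingEquiv.toRingHom_eq_coe]
  -- `a⁻¹ c ∈ H'`: for every `g`, `g a⁻¹ c ∈ S ↔ g ∈ S`, through the `τ ∈ Aut(ℂ)` by which `g a⁻¹` acts
  have hu : a⁻¹ * c ∈ H' := by
    refine (mem_stabilizer_reflexLift_iff (algValuedIn ι Ψ) j _).2 fun g ↦ ?_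
    obtain ⟨τ, hτ⟩ := exists_ringEquiv_forall_algHomEquivRingHomOfNormal_smul j ι (g * a⁻¹)
    rw [mem_typeLift, mem_typeLift, smul_mem_algValuedIn_iff, smul_mem_algValuedIn_iff,
      show (g * (a⁻¹ * c)) • j = (g * a⁻¹) • (c • j) by rw [← mul_smul, mul_assoc],
      show g • j = (g * a⁻¹) • (a • j) by rw [← mul_smul, inv_mul_cancel_right], hτ, hτ, hs, ht, hsm, hsm]
    exact (hpat τ).symm
  -- `a⁻¹ c` moves `j`
  have hne : (a⁻¹ * c) • j ≠ j := by
    intro heq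
    apply hst
    rw [← hs, ← ht, show c • j = a • ((a⁻¹ * c) • j) by rw [← mul_smul, mul_inv_cancel_left], heq]
  obtain ⟨x, hx⟩ : ∃ x, ((a⁻¹ * c) • j) x ≠ j x := by
    by_contra hall
    push Not at hall
    exact hne (AlgHom.ext hall)
  refine ⟨x, fun hmem ↦ hx ?_⟩
  rw [IntermediateField.mem_fixedField_iff] at hmem
  rw [algEquiv_smul_apply]
  exact hmem _ hu

end Galois

/-! ## §2 Extension of embeddings from a subfield -/

section Extend

variable {M : Type} [Field M] [NumberField M]

/-- Every complex embedding `σ₀` of a subfield `K ⊆ M` of a number field extends to `M`: move the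
restriction of any `σ₁ : M → ℂ` to `σ₀` by an automorphism of `ℂ` (`Aut(ℂ)` is transitive on `Hom(K, ℂ)`,
the tree's `Pohlmann1968.isPretransitive_ringEquiv_complex`) (private helper). [folklore] -/
private theorem exists_ringHom_comp_algebraMap_eq (K : IntermediateField ℚ M) (σ₀ : K →+* ℂ) (σ₁ : M →+* ℂ) :
    ∃ σ : M →+* ℂ, σ.comp (algebraMap K M) = σ₀ := by
  haveI := Literature.AlgebraicGeometry.Pohlmann1968.isPretransitive_ringEquiv_complex (K := K)
  obtain ⟨τ, hτ⟩ := MulAction.exists_smul_eq (ℂ ≃+* ℂ) (σ₁.comp (algebraMap K M)) σ₀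
  refine ⟨τ.toRingHom.comp σ₁, ?_⟩
  rw [RingHom.comp_assoc, ← ringEquiv_smul_def]
  exact hτ

end Extend

/-! ## §3 A non-primitive CM type is induced from a proper subfield -/

/-- **A CM type that is not primitive is induced from a CM type of a PROPER subfield** (Shimura 1998 §8.2,
proof of Prop. 26: `Φ` is induced from the field `K'` of `H' = {γ | γS = S}`, and `K' = M` iff `H' = H₁` iff
`Φ` is primitive; Streng 2010 Ch. I Def. 3.2, (3.6)).  In the `Aut(ℂ)`-language of the tree
(`ComplexMultiplication.isPrimitive_ringEquiv_complex_iff`): if two distinct embeddings `s ≠ t : M → ℂ` have the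
same pattern `τ ∘ s ∈ Φ ⟺ τ ∘ t ∈ Φ` (`τ ∈ Aut(ℂ)`), then there are an intermediate field `K ⊊ M` and a CM type
`Φ₀` of `K` with `Φ = Φ₀^M = {σ | σ|_K ∈ Φ₀}` (`inducedCMType (algebraMap K M) Φ₀ = Φ`).  Here `K = j⁻¹(L^{H'})`
for the Galois closure `L = M^c ⊂ ℂ` (`GaoUllmo2025.galoisClosure`), and `Φ₀ = {σ|_K | σ ∈ Φ}` is a CM type
because membership in `Φ` depends on `σ|_K` only (`mem_iff_mem_of_forall_mem_fixedField`) and `σ̄|_K = \overline{σ|_K}`.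
[cite: Shimura1998, §8.2 Prop. 26 and its proof (pp. 61–63)] [cite: Streng2010, Ch. I Def. 3.2, Lemma 3.5, (3.6)] -/
theorem exists_inducedCMType_of_not_primitive {M : Type} [Field M] [NumberField M] (Φ : CMType M)
    {s t : M →+* ℂ} (hst : s ≠ t)
    (hpat : ∀ τ : ℂ ≃+* ℂ, (τ : ℂ →+* ℂ).comp s ∈ Φ.1 ↔ (τ : ℂ →+* ℂ).comp t ∈ Φ.1) :
    ∃ (K : IntermediateField ℚ M) (Φ₀ : CMType K), K ≠ ⊤ ∧ inducedCMType (algebraMap K M) Φ₀ = Φ := by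
  classical
  -- the Galois closure `L = M^c ⊂ ℂ`, `j : M → L`, `ι : L ⊂ ℂ`
  let L := Literature.AlgebraicGeometry.GaoUllmo2025.galoisClosure M
  let j : M →ₐ[ℚ] L := Literature.AlgebraicGeometry.GaoUllmo2025.corestrict M s.toRatAlgHom
  let ι : L →+* ℂ := algebraMap L ℂ
  let H' := MulAction.stabilizer (L ≃ₐ[ℚ] L) (reflexLift (algValuedIn ι Φ.1) j : Set (L ≃ₐ[ℚ] L))
  -- `K = j⁻¹(L^{H'})`
  let K : IntermediateField ℚ M := (IntermediateField.fixedField H').comap j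
  have hK : ∀ x : M, x ∈ K ↔ j x ∈ IntermediateField.fixedField H' := fun x ↦ Iff.rfl
  -- membership in `Φ` depends on the restriction to `K` only
  have key : ∀ σ σ' : M →+* ℂ, σ.comp (algebraMap K M) = σ'.comp (algebraMap K M) → (σ ∈ Φ.1 ↔ σ' ∈ Φ.1) := by
    intro σ σ' hσσ'
    refine mem_iff_mem_of_forall_mem_fixedField j ι Φ.1 σ σ' fun x hx ↦ ?_
    have := RingHom.congr_fun hσσ' ⟨x, (hK x).2 hx⟩
    exact this
  -- `K ≠ M`
  obtain ⟨x₀, hx₀⟩ := exists_not_mem_fixedField_of_ne j ι Φ.1 hst hpat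
  have hKtop : K ≠ ⊤ := by
    intro htop
    have : x₀ ∈ K := by rw [htop]; exact IntermediateField.mem_top
    exact hx₀ ((hK x₀).1 this)
  -- the CM type `Φ₀ = {σ|_K | σ ∈ Φ}` of `K`
  let S₀ : Set (K →+* ℂ) := {σ₀ | ∃ σ ∈ Φ.1, σ.comp (algebraMap K M) = σ₀}
  have hS₀ : ∀ σ : M →+* ℂ, σ.comp (algebraMap K M) ∈ S₀ ↔ σ ∈ Φ.1 := by
    intro σ
    constructor
    · rintro ⟨σ', hσ', h⟩
      exact (key σ' σ h).1 hσ'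
    · exact fun hσ ↦ ⟨σ, hσ, rfl⟩
  have hCM : ∀ σ₀ : K →+* ℂ, σ₀ ∈ S₀ ↔ ComplexEmbedding.conjugate σ₀ ∉ S₀ := by
    intro σ₀
    obtain ⟨σ, rfl⟩ := exists_ringHom_comp_algebraMap_eq K σ₀ s
    rw [conjugate_comp_ringHom, hS₀, hS₀]
    exact Φ.2 σ
  refine ⟨K, ⟨S₀, hCM⟩, hKtop, Subtype.ext (Set.ext fun τ ↦ ?_)⟩
  rw [mem_inducedCMType_iff]
  exact hS₀ τ

/-- **The subfield in `exists_inducedCMType_of_not_primitive` is proper as a map**: `algebraMap K M` is not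
surjective. [cite: Shimura1998, §8.2 Prop. 26] -/
theorem exists_inducedCMType_of_not_primitive' {M : Type} [Field M] [NumberField M] (Φ : CMType M)
    {s t : M →+* ℂ} (hst : s ≠ t)
    (hpat : ∀ τ : ℂ ≃+* ℂ, (τ : ℂ →+* ℂ).comp s ∈ Φ.1 ↔ (τ : ℂ →+* ℂ).comp t ∈ Φ.1) :
    ∃ (K : IntermediateField ℚ M) (Φ₀ : CMType K),
      ¬ Function.Surjective (algebraMap K M) ∧ inducedCMType (algebraMap K M) Φ₀ = Φ := by
  obtain ⟨K, Φ₀, hK, hΦ⟩ := exists_inducedCMType_of_not_primitive Φ hst hpat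
  refine ⟨K, Φ₀, fun hsurj ↦ hK ?_, hΦ⟩
  rw [eq_top_iff]
  intro x _
  obtain ⟨y, rfl⟩ := hsurj x
  exact y.2

end Literature.NumberTheory.ComplexMultiplication


namespace Literature.NumberTheory.ComplexMultiplication

open Literature.AlgebraicGeometry.Motives (CMType)
open NumberField

/-! ## §4 Conversely: a type induced from a proper subfield is not primitive -/

/-- **A CM type induced from a PROPER subfield is not primitive** (the easy half of Streng Def. 3.2 ⟺ Shimura's
`H₁ = H'`): if `Φ = Φ₀^M` along `k : K → M` with `[K:ℚ] < [M:ℚ]`, then two DISTINCT embeddings `s ≠ t : M → ℂ`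
have the same pattern `τ ∘ s ∈ Φ ⟺ τ ∘ t ∈ Φ` (`τ ∈ Aut(ℂ)`): any two of the `[M:K] ≥ 2` extensions of one
embedding of `K` (counted by Mathlib's `AlgHom.card`), since membership in `Φ₀^M` is read on `K`.
[cite: Streng2010, Ch. I Def. 3.2 and (3.6)] [cite: Shimura1998, §8.2 Prop. 26] -/
theorem exists_ne_of_inducedCMType {M : Type} [Field M] [NumberField M] {K : Type} [Field K] [NumberField K]
    (k : K →+* M) (Φ₀ : CMType K) (hlt : Module.finrank ℚ K < Module.finrank ℚ M) :
    ∃ s t : M →+* ℂ, s ≠ t ∧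
      ∀ τ : ℂ ≃+* ℂ, (τ : ℂ →+* ℂ).comp s ∈ (inducedCMType k Φ₀).1 ↔ (τ : ℂ →+* ℂ).comp t ∈ (inducedCMType k Φ₀).1 := by
  classical
  obtain ⟨s₀⟩ := (inferInstance : Nonempty (M →+* ℂ))
  letI : Algebra K M := k.toAlgebra
  letI : Algebra K ℂ := (s₀.comp k).toAlgebra
  -- `[M:K] ≥ 2`
  have hmul := Module.finrank_mul_finrank ℚ K M
  have h2 : 1 < Module.finrank K M := by
    by_contra h
    have h1 : Module.finrank K M ≤ 1 := by omega
    have : Module.finrank ℚ M ≤ Module.finrank ℚ K := by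
      rw [← hmul]
      calc Module.finrank ℚ K * Module.finrank K M ≤ Module.finrank ℚ K * 1 := Nat.mul_le_mul_left _ h1
        _ = Module.finrank ℚ K := mul_one _
    omega
  -- two distinct `K`-embeddings `M → ℂ`
  have hcard : Fintype.card (M →ₐ[K] ℂ) = Module.finrank K M := AlgHom.card K M ℂ
  obtain ⟨t₁, t₂, hne⟩ := Fintype.exists_pair_of_one_lt_card (by rw [hcard]; exact h2)
  refine ⟨t₁.toRingHom, t₂.toRingHom, fun h ↦ hne (AlgHom.coe_ringHom_injective h), fun τ ↦ ?_⟩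
  have h₁ : (t₁.toRingHom).comp k = s₀.comp k := t₁.comp_algebraMap
  have h₂ : (t₂.toRingHom).comp k = s₀.comp k := t₂.comp_algebraMap
  rw [mem_inducedCMType_iff, mem_inducedCMType_iff, RingHom.comp_assoc, RingHom.comp_assoc, h₁, h₂]

/-- The same with «`k` not surjective» in place of the degree inequality. [cite: Streng2010, Ch. I Def. 3.2] -/
theorem exists_ne_of_inducedCMType_of_not_surjective {M : Type} [Field M] [NumberField M] {K : Type} [Field K]
    [NumberField K] (k : K →+* M) (Φ₀ : CMType K) (hk : ¬ Function.Surjective k) :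
    ∃ s t : M →+* ℂ, s ≠ t ∧
      ∀ τ : ℂ ≃+* ℂ, (τ : ℂ →+* ℂ).comp s ∈ (inducedCMType k Φ₀).1 ↔ (τ : ℂ →+* ℂ).comp t ∈ (inducedCMType k Φ₀).1 := by
  refine exists_ne_of_inducedCMType k Φ₀ ?_
  let k' : K →ₐ[ℚ] M := k.toRatAlgHom
  have hle : Module.finrank ℚ K ≤ Module.finrank ℚ M :=
    LinearMap.finrank_le_finrank_of_injective (f := k'.toLinearMap) k.injective
  refine lt_of_le_of_ne hle fun heq ↦ hk ?_
  have hbij : Function.Bijective k'.toLinearMap :=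
    ⟨k.injective, (LinearMap.injective_iff_surjective_of_finrank_eq_finrank heq).1 k.injective⟩
  exact hbij.2

/-- **Streng Def. 3.2 ⟺ Shimura's `H₁ = H'`, for CM types of a number field `M`**: `Φ` is primitive in the
`Aut(ℂ)`-form (embeddings with the same pattern coincide) iff `Φ` is NOT induced from a CM type of a proper
subfield. [cite: Streng2010, Ch. I Def. 3.2, Lemma 3.5, (3.6)] [cite: Shimura1998, §8.2 Prop. 26] -/
theorem primitive_iff_not_exists_inducedCMType {M : Type} [Field M] [NumberField M] (Φ : CMType M) :
    (∀ s t : M →+* ℂ, (∀ τ : ℂ ≃+* ℂ, ((τ : ℂ →+* ℂ).comp s ∈ Φ.1 ↔ (τ : ℂ →+* ℂ).comp t ∈ Φ.1)) → s = t) ↔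
      ¬ ∃ (K : IntermediateField ℚ M) (Φ₀ : CMType K), K ≠ ⊤ ∧ inducedCMType (algebraMap K M) Φ₀ = Φ := by
  constructor
  · rintro hprim ⟨K, Φ₀, hK, rfl⟩
    have hk : ¬ Function.Surjective (algebraMap K M) := by
      intro hsurj
      apply hK
      rw [eq_top_iff]
      intro x _
      obtain ⟨y, rfl⟩ := hsurj x
      exact y.2
    obtain ⟨s, t, hst, hpat⟩ := exists_ne_of_inducedCMType_of_not_surjective (algebraMap K M) Φ₀ hk
    exact hst (hprim s t hpat)
  · intro h s t hpat
    by_contra hst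
    exact h (exists_inducedCMType_of_not_primitive Φ hst hpat)

end Literature.NumberTheory.ComplexMultiplication

end
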